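import Mathlib
import Summits.ResolutionOfSingularities.ResolutionOfSingularities.Theorems.RadicialJungCleanModelsContactChainCapstoneExcellent
import Summits.ResolutionOfSingularities.ResolutionOfSingularities.Theorems.RadicialJungCleanModelsContactChainSimpleContaining
import Summits.ResolutionOfSingularities.ResolutionOfSingularities.Theorems.RadicialJungCleanModelsContactChainSimpleNormalForm
import Summits.ResolutionOfSingularities.ResolutionOfSingularities.Theorems.RadicialJungCleanModelsContactChainOfCleanRegAt
import HarnessLib

/-!
# Route `RadicialJung`, crux `CleanModels` (stmt-ResolutionOfSingularities-15917), line `Sketch` rev 35, stub 6 `stub_cleanProp44` (X44c),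
# work plan O8 / L7b — THE FIRST-ORDER COLLAPSE: a representative which is not a `p`-th power modulo `𝓘_{C₀,x₀}²` forces the exit

Memo `Cruxes/CleanModels/Lines/Sketch-memo-hand2-g8-stubs-5-7.md` §2 ((T1), (T2a), (T2) entry).  With the defectlessness hypothesis gone
(✓ `…ContactChainCapstoneExcellent.lean`), the two typed exit mechanisms of L7b read, for an INTEGRAL representative `R ∈ 𝒪_{X₀,x₀}` of the line
(`Σ_j cc_j^p G^j = R`, some `cc_j ≠ 0` with `j ≠ 0`) at a closed point `x₀` (`dim 𝒪_{X₀,x₀} = 3`) of a regular curve `C₀` on a regular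
quasi-excellent `X₀`, `P := 𝓘_{C₀,x₀}`:

* (T1′) `exists_pointChain_cleanPermissibleAt_of_rep_residue_not_pow` — `R ∉ P` and `R̄ ∈ 𝒪_{C₀,x₀}` NOT a `p`-th power (`∀ c, R − c^p ∉ P`)
  ⟹ exit: contact normal form `R = γ w^k + π` (✓ `exists_contact_normalForm`); `p ∤ k` charged (✓ `exists_pointChain_cleanPermissibleAt`, one
  transversal component), `p ∣ k` by the restart / best-approximation exit (✓ `exists_pointChain_cleanPermissibleAt_of_isQuasiExcellent`, `γ̄ ∉ D^p`);
* (T2a′) `exists_pointChain_cleanPermissibleAt_of_rep_mem_not_mem_sq` — `R ∈ P ∖ P²` ⟹ exit: `R = λ₀t₀ + λ₁t₁` with some `λ_i ∉ P`, simple normal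
  form (✓ `exists_simple_normalForm`), saturation along a chain of `j` point blow-ups (✓ `cleanPermissibleAt_of_pointChain_simpleContaining`, `a = 1`);
* THE COLLAPSE `exists_pointChain_cleanPermissibleAt_of_rep_not_pow_mod_sq` — **if some integral representative `R` of the line is NOT a `p`-th
  power modulo `P²` (`∀ c, R − c^p ∉ P²`), then a dominant chain of point blowing ups following `C₀` reaches a clean-permissible landing** (shift
  `R ↦ R − c^p`, ✓ `rep_shift_sub_pow`, reduces `R ∉ P`, `R̄ = c̄^p` to (T2a′)).  NO cleanness hypothesis on the line is used;
* `exists_pointChain_cleanPermissibleAt_or_forall_rep_pow_mod_sq_of_cleanRegAt` — the capstone's residual in FIRST-ORDER form: under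
  `CleanRegAt p (toFunctionField x₀) G`, exit ∨ (the all-transversal uncharged configuration of ✓ p813775 whose SHIFTED representative
  `u∏s_i^{a_i} − (c w^{N'})^p` lies in `P²`, AND every integral representative of the line is a `p`-th power modulo `P²`).

So what remains of O8 (L7b) is a statement about the first infinitesimal neighbourhood `𝒪_{X₀,x₀}/𝓘_{C₀,x₀}²` only: lines all of whose integral
representatives are `p`-th powers modulo `𝓘²_{C₀,x₀}` (the memo's (T2b) configurations `v q₁^{α₁} q₂^{α₂}`, `α₁ + α₂ ≥ 2`, live here).
Honest framing: OURS; nothing here proves resolution in characteristic `p`, X44c, or any case of `CleanModels`.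
-/

noncomputable section

set_option linter.dupNamespace false -- mandated namespace of this single-conjunct summit

open CategoryTheory AlgebraicGeometry TopologicalSpace IsLocalRing
open Literature.AlgebraicGeometry.Resolution Literature.AlgebraicGeometry.Motives
open Scheme.IdealSheafData

namespace Summit.ResolutionOfSingularities.ResolutionOfSingularities.Theorems.RadicialJung.CleanModels

/-- **(T1′) A representative off the curve whose restriction to the curve is not a `p`-th power forces the exit.**  On a regular integral
quasi-excellent `X₀` (`char K(X₀) = p`), at a closed point `x₀` (`dim 𝒪_{X₀,x₀} = 3`) of a regular curve `C₀` with transversal parameter `w`: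
if the line of `G` has an integral representative `R ∉ 𝓘_{C₀,x₀}` with `R − c^p ∉ 𝓘_{C₀,x₀}` for every `c`, then a dominant chain of point blowing
ups following `C₀` ends at a point where the line of `σ^♯ G` is clean-permissible for the strict transform.
[cite: CossartJannsenSaito2020, proof of Thm. 6.28, Step 5] [cite: Kuhlmann2010, Section 1 (p. 3 of arXiv:1003.5678)] -/
theorem exists_pointChain_cleanPermissibleAt_of_rep_residue_not_pow {X₀ : Scheme.{0}} [IsIntegral X₀] [IsLocallyNoetherian X₀]
    (hX₀ : Scheme.IsRegular X₀) (hE : Scheme.IsQuasiExcellent X₀) (p : ℕ) [hp : Fact p.Prime] [CharP X₀.functionField p] {C₀ : Closeds X₀}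
    (hC₀reg : ∀ y ∈ (C₀ : Set X₀), ∃ c : Fin 2 → X₀.presheaf.stalk y,
      IsRsopPart c ∧ Ideal.span (Set.range c) = stalkIdeal (vanishingIdeal C₀) y)
    {x₀ : X₀} (hx₀ : IsClosed ({x₀} : Set X₀)) (hx₀C : x₀ ∈ (C₀ : Set X₀)) (hdim₀ : ringKrullDim (X₀.presheaf.stalk x₀) = 3)
    [hP : (stalkIdeal (vanishingIdeal C₀) x₀).IsPrime]
    (w : X₀.presheaf.stalk x₀) (hw : stalkIdeal (vanishingIdeal C₀) x₀ ⊔ Ideal.span {w} = maximalIdeal _)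
    (G : X₀.functionField) (cc : Fin p → X₀.functionField) (hcc : ∃ j : Fin p, (j : ℕ) ≠ 0 ∧ cc j ≠ 0)
    (R : X₀.presheaf.stalk x₀) (hX : (∑ j : Fin p, cc j ^ p * G ^ (j : ℕ)) = RatFn.toFunctionField x₀ R)
    (hRP : R ∉ stalkIdeal (vanishingIdeal C₀) x₀) (hRpow : ∀ c : X₀.presheaf.stalk x₀, R - c ^ p ∉ stalkIdeal (vanishingIdeal C₀) x₀) :
    ∃ (X : Scheme.{0}) (_ : IsIntegral X) (_ : IsLocallyNoetherian X) (σ : X ⟶ X₀) (_ : IsDominant σ) (C : Closeds X) (x : X) (n : ℕ),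
      IsPointChainAlong σ C₀ C x n ∧ σ x = x₀ ∧ IsClosed ({x} : Set X) ∧
      CleanPermissibleAt p (RatFn.toFunctionField x) (RatFn.functionFieldMap σ G) (stalkIdeal (vanishingIdeal C) x) := by
  classical
  haveI : IsRegularLocalRing (X₀.presheaf.stalk x₀) := hX₀ x₀
  set P := stalkIdeal (vanishingIdeal C₀) x₀ with hPdef
  obtain ⟨t, ht, htP⟩ := hC₀reg x₀ hx₀C
  -- contact normal form `R = γ w^k + π`
  obtain ⟨k, γ, π, hγ, hπ, hRk⟩ := exists_contact_normalForm P w hw R hRP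
  -- the representative as `1 · (t₀⁰ t₁⁰) · (γ w^k + π)¹`
  have hX1 : (∑ j : Fin p, cc j ^ p * G ^ (j : ℕ)) = RatFn.toFunctionField x₀
      (1 * (∏ j, t j ^ (fun _ : Fin 2 => 0) j) * ∏ i : Fin 1, ((fun _ => γ) i * w ^ (fun _ => k) i + (fun _ => π) i) ^ (fun _ : Fin 1 => 1) i) := by
    rw [hX, hRk]; simp
  by_cases hk : p ∣ k
  · -- uncharged single component: `γ̄` is not a `p`-th power, restart exit (defectlessness from quasi-excellence)
    obtain ⟨N', hN'⟩ := hk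
    have hγpow : ∀ c : X₀.presheaf.stalk x₀, 1 * ∏ i : Fin 1, (fun _ => γ) i ^ (fun _ : Fin 1 => 1) i - c ^ p ∉ P := by
      intro c hc
      simp only [Finset.univ_unique, Fin.default_eq_zero, Fin.isValue, pow_one, Finset.prod_singleton, one_mul] at hc
      apply hRpow (c * w ^ N')
      have : R - (c * w ^ N') ^ p = (γ - c ^ p) * w ^ k + π := by rw [hRk, hN', mul_pow, ← pow_mul, mul_comm N' p]; ring
      rw [this]
      exact P.add_mem (Ideal.mul_mem_right _ _ hc) hπ
    have hX2 : (∑ j : Fin p, cc j ^ p * G ^ (j : ℕ)) = RatFn.toFunctionField x₀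
        (1 * ∏ i : Fin 1, ((fun _ => γ) i * w ^ (fun _ => k) i + (fun _ => π) i) ^ (fun _ : Fin 1 => 1) i) := by
      rw [hX, hRk]; simp
    obtain ⟨X, hXi, hXn, σ, hσ, C, x, n, h, hσx, hxcl, hperm⟩ :=
      exists_pointChain_cleanPermissibleAt_of_isQuasiExcellent hX₀ hE p hC₀reg hx₀ hx₀C hdim₀ G cc hcc w 1 hw isUnit_one
        (fun _ : Fin 1 => γ) (fun _ => π) (fun _ => hγ) (fun _ => hπ) (fun _ => k) (fun _ => 1) (N' := N')
        (by simp [hN', mul_comm]) hX2 hγpow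
    exact ⟨X, hXi, hXn, σ, hσ, C, x, n, h, hσx, hxcl, hperm⟩
  · -- charged single component
    obtain ⟨X, hXi, hXn, σ, hσ, C, x, h, hσx, hxcl, hperm⟩ :=
      exists_pointChain_cleanPermissibleAt hX₀ hC₀reg hx₀ hx₀C hdim₀ p G cc hcc w 1 hw isUnit_one t ht htP (fun _ => 0)
        (fun _ : Fin 1 => γ) (fun _ => π) (fun _ => hγ) (fun _ => hπ) (fun _ => k) (fun _ => 1) (Or.inr (by simpa using hk)) hX1
    exact ⟨X, hXi, hXn, σ, hσ, C, x, _, h, hσx, hxcl, hperm⟩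

/-- **(T2a′) A representative in `𝓘_{C₀,x₀} ∖ 𝓘_{C₀,x₀}²` forces the exit.**  Same setting (quasi-excellence not needed): if the line of `G` has an
integral representative `R ∈ 𝓘_{C₀,x₀}` with `R ∉ 𝓘_{C₀,x₀}²`, then a dominant chain of point blowing ups following `C₀` ends at a point where the
line of `σ^♯ G` is clean-permissible for the strict transform — `R = λ₀t₀ + λ₁t₁` with some `λ_i ∉ 𝓘_{C₀,x₀}`, simple normal form
`Σ (w^j μ_i + π_i) t_i` (`μ_{i₀}` a unit), and after `j` point blow-ups `(R⁽ʲ⁾, t⁽ʲ⁾_{i₁})` is a generating regular pair of the strict transform.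
[cite: CossartJannsenSaito2020, proof of Thm. 6.28, Step 5] [cite: Matsumura1987, Thm. 14.2] -/
theorem exists_pointChain_cleanPermissibleAt_of_rep_mem_not_mem_sq {X₀ : Scheme.{0}} [IsIntegral X₀] [IsLocallyNoetherian X₀]
    (hX₀ : Scheme.IsRegular X₀) (p : ℕ) [hp : Fact p.Prime] {C₀ : Closeds X₀}
    (hC₀reg : ∀ y ∈ (C₀ : Set X₀), ∃ c : Fin 2 → X₀.presheaf.stalk y,
      IsRsopPart c ∧ Ideal.span (Set.range c) = stalkIdeal (vanishingIdeal C₀) y)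
    {x₀ : X₀} (hx₀ : IsClosed ({x₀} : Set X₀)) (hx₀C : x₀ ∈ (C₀ : Set X₀)) (hdim₀ : ringKrullDim (X₀.presheaf.stalk x₀) = 3)
    (w : X₀.presheaf.stalk x₀) (hw : stalkIdeal (vanishingIdeal C₀) x₀ ⊔ Ideal.span {w} = maximalIdeal _)
    (G : X₀.functionField) (cc : Fin p → X₀.functionField) (hcc : ∃ j : Fin p, (j : ℕ) ≠ 0 ∧ cc j ≠ 0)
    (R : X₀.presheaf.stalk x₀) (hX : (∑ j : Fin p, cc j ^ p * G ^ (j : ℕ)) = RatFn.toFunctionField x₀ R)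
    (hRP : R ∈ stalkIdeal (vanishingIdeal C₀) x₀) (hR2 : R ∉ stalkIdeal (vanishingIdeal C₀) x₀ ^ 2) :
    ∃ (X : Scheme.{0}) (_ : IsIntegral X) (_ : IsLocallyNoetherian X) (σ : X ⟶ X₀) (_ : IsDominant σ) (C : Closeds X) (x : X) (n : ℕ),
      IsPointChainAlong σ C₀ C x n ∧ σ x = x₀ ∧ IsClosed ({x} : Set X) ∧
      CleanPermissibleAt p (RatFn.toFunctionField x) (RatFn.functionFieldMap σ G) (stalkIdeal (vanishingIdeal C) x) := by
  classical
  haveI : IsRegularLocalRing (X₀.presheaf.stalk x₀) := hX₀ x₀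
  set P := stalkIdeal (vanishingIdeal C₀) x₀ with hPdef
  obtain ⟨t, ht, htP⟩ := hC₀reg x₀ hx₀C
  -- `R = Σ λ_i t_i` with some `λ_i ∉ P`
  obtain ⟨lam, hlam⟩ : ∃ lam : Fin 2 → X₀.presheaf.stalk x₀, (∑ i, lam i * t i) = R := by
    have : R ∈ Ideal.span (Set.range t) := by rw [htP]; exact hRP
    exact Ideal.mem_span_range_iff_exists_fun.mp this
  obtain ⟨i₀, hi₀⟩ : ∃ i₀, lam i₀ ∉ P := by
    by_contra hall
    push Not at hall
    apply hR2
    rw [← hlam, pow_two]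
    exact Ideal.sum_mem _ fun i _ => Ideal.mul_mem_mul (hall i) (by rw [hPdef, ← htP]; exact Ideal.subset_span ⟨i, rfl⟩)
  -- simple normal form
  obtain ⟨j, μ, π, ⟨i₁, hμ⟩, hπ, hnf⟩ := exists_simple_normalForm P w hw t lam hi₀
  obtain ⟨i₂, hi₂⟩ : ∃ i₂ : Fin 2, i₁ ≠ i₂ := ⟨i₁ + 1, by fin_cases i₁ <;> simp⟩
  -- a chain of `j` point blow-ups following the curve
  obtain ⟨X, hXi, hXn, σ, hσ, C, x, h, hσx, hxcl⟩ := exists_pointChainAlong_isDominant hX₀ hC₀reg hx₀ hx₀C hdim₀ j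
  subst hσx
  refine ⟨X, hXi, hXn, σ, hσ, C, x, j, h, rfl, hxcl, ?_⟩
  have hX' : (∑ l : Fin p, cc l ^ p * G ^ (l : ℕ)) = RatFn.toFunctionField (σ x)
      (1 * (∑ i, (w ^ j * μ i + π i) * t i) ^ 1 *
        ∏ i : Fin 0, ((Fin.elim0 i : X₀.presheaf.stalk (σ x)) * w ^ (Fin.elim0 i : ℕ) + (Fin.elim0 i : X₀.presheaf.stalk (σ x))) ^
          (Fin.elim0 i : ℕ)) := by
    rw [hX, ← hlam, hnf]; simp
  exact cleanPermissibleAt_of_pointChain_simpleContaining h hX₀ hC₀reg hx₀C hdim₀ p G cc hcc w 1 hw isUnit_one t ht htP j μ π hπ hi₂ hμ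
    1 (fun h1 => hp.out.ne_one (Nat.dvd_one.mp h1)) le_rfl (fun i => Fin.elim0 i) (fun i => Fin.elim0 i) (fun i => Fin.elim0 i)
    (fun i => Fin.elim0 i) (fun i => Fin.elim0 i) (fun i => Fin.elim0 i) (fun i => Fin.elim0 i) hX'

/-- **THE FIRST-ORDER COLLAPSE of L7b.**  On a regular integral quasi-excellent `X₀` (`char K(X₀) = p`), at a closed point `x₀` (`dim 𝒪_{X₀,x₀} = 3`)
of a regular curve `C₀` with transversal parameter `w`: if the line of `G` has an integral representative `R ∈ 𝒪_{X₀,x₀}` which is NOT a `p`-th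
power modulo `𝓘_{C₀,x₀}²` (`∀ c, R − c^p ∉ 𝓘²_{C₀,x₀}`), then a dominant chain of point blowing ups following `C₀` ends at a point where the line
of `σ^♯ G` is clean-permissible for the strict transform.  (`R ∈ 𝓘`: (T2a′); `R ∉ 𝓘` with `R̄` not a `p`-th power: (T1′); `R ∉ 𝓘`, `R ≡ c^p (𝓘)`:
shift by `c^p` — ✓ `rep_shift_sub_pow` — and (T2a′).)  No cleanness hypothesis on the line is used.
[cite: CossartJannsenSaito2020, proof of Thm. 6.28, Step 5] [cite: Kuhlmann2010, Section 1 (p. 3 of arXiv:1003.5678)] -/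
theorem exists_pointChain_cleanPermissibleAt_of_rep_not_pow_mod_sq {X₀ : Scheme.{0}} [IsIntegral X₀] [IsLocallyNoetherian X₀]
    (hX₀ : Scheme.IsRegular X₀) (hE : Scheme.IsQuasiExcellent X₀) (p : ℕ) [hp : Fact p.Prime] [CharP X₀.functionField p] {C₀ : Closeds X₀}
    (hC₀reg : ∀ y ∈ (C₀ : Set X₀), ∃ c : Fin 2 → X₀.presheaf.stalk y,
      IsRsopPart c ∧ Ideal.span (Set.range c) = stalkIdeal (vanishingIdeal C₀) y)
    {x₀ : X₀} (hx₀ : IsClosed ({x₀} : Set X₀)) (hx₀C : x₀ ∈ (C₀ : Set X₀)) (hdim₀ : ringKrullDim (X₀.presheaf.stalk x₀) = 3)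
    [hP : (stalkIdeal (vanishingIdeal C₀) x₀).IsPrime]
    (w : X₀.presheaf.stalk x₀) (hw : stalkIdeal (vanishingIdeal C₀) x₀ ⊔ Ideal.span {w} = maximalIdeal _)
    (G : X₀.functionField) (cc : Fin p → X₀.functionField) (hcc : ∃ j : Fin p, (j : ℕ) ≠ 0 ∧ cc j ≠ 0)
    (R : X₀.presheaf.stalk x₀) (hX : (∑ j : Fin p, cc j ^ p * G ^ (j : ℕ)) = RatFn.toFunctionField x₀ R)
    (hR : ∀ c : X₀.presheaf.stalk x₀, R - c ^ p ∉ stalkIdeal (vanishingIdeal C₀) x₀ ^ 2) :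
    ∃ (X : Scheme.{0}) (_ : IsIntegral X) (_ : IsLocallyNoetherian X) (σ : X ⟶ X₀) (_ : IsDominant σ) (C : Closeds X) (x : X) (n : ℕ),
      IsPointChainAlong σ C₀ C x n ∧ σ x = x₀ ∧ IsClosed ({x} : Set X) ∧
      CleanPermissibleAt p (RatFn.toFunctionField x) (RatFn.functionFieldMap σ G) (stalkIdeal (vanishingIdeal C) x) := by
  classical
  by_cases hRP : R ∈ stalkIdeal (vanishingIdeal C₀) x₀
  · have h2 : R ∉ stalkIdeal (vanishingIdeal C₀) x₀ ^ 2 := by simpa [zero_pow hp.out.ne_zero] using hR 0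
    exact exists_pointChain_cleanPermissibleAt_of_rep_mem_not_mem_sq hX₀ p hC₀reg hx₀ hx₀C hdim₀ w hw G cc hcc R hX hRP h2
  · by_cases hres : ∀ c : X₀.presheaf.stalk x₀, R - c ^ p ∉ stalkIdeal (vanishingIdeal C₀) x₀
    · exact exists_pointChain_cleanPermissibleAt_of_rep_residue_not_pow hX₀ hE p hC₀reg hx₀ hx₀C hdim₀ w hw G cc hcc R hX hRP hres
    · push Not at hres
      obtain ⟨c, hc⟩ := hres
      obtain ⟨cc', hcc', hX'⟩ := rep_shift_sub_pow p (RatFn.toFunctionField x₀) G cc hcc R c hX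
      exact exists_pointChain_cleanPermissibleAt_of_rep_mem_not_mem_sq hX₀ p hC₀reg hx₀ hx₀C hdim₀ w hw G cc' hcc' (R - c ^ p) hX' hc (hR c)

/-- **The capstone's residual in first-order form.**  Under `CleanRegAt p (toFunctionField x₀) G` (same setting): EITHER a dominant chain of point
blowing ups following `C₀` reaches a clean-permissible landing, OR (i) EVERY integral representative of the line is a `p`-th power modulo
`𝓘_{C₀,x₀}²` AND (ii) the line is in the all-transversal uncharged configuration of ✓ `exists_pointChain_cleanPermissibleAt_or_pthPower_of_cleanRegAt`
(`u · ∏ s_i^{a_i}`, `s_i = γ_i w^{k_i} + π_i`, `p ∣ Σ k_i a_i`, `u ∏ γ_i^{a_i} ≡ c^p (𝓘_{C₀,x₀})`).  What is left of L7b is thus a question about the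
first infinitesimal neighbourhood `𝒪_{X₀,x₀}/𝓘²_{C₀,x₀}` of the curve at the point (the memo's (T2b)).
[cite: CossartJannsenSaito2020, proof of Thm. 6.28, Step 5] [cite: Piltant2013, §2 Axiom 4] -/
theorem exists_pointChain_cleanPermissibleAt_or_forall_rep_pow_mod_sq_of_cleanRegAt {X₀ : Scheme.{0}} [IsIntegral X₀]
    [IsLocallyNoetherian X₀] (hX₀ : Scheme.IsRegular X₀) (hE : Scheme.IsQuasiExcellent X₀) (p : ℕ) [Fact p.Prime] [CharP X₀.functionField p]
    {C₀ : Closeds X₀}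
    (hC₀reg : ∀ y ∈ (C₀ : Set X₀), ∃ c : Fin 2 → X₀.presheaf.stalk y,
      IsRsopPart c ∧ Ideal.span (Set.range c) = stalkIdeal (vanishingIdeal C₀) y)
    {x₀ : X₀} (hx₀ : IsClosed ({x₀} : Set X₀)) (hx₀C : x₀ ∈ (C₀ : Set X₀)) (hdim₀ : ringKrullDim (X₀.presheaf.stalk x₀) = 3)
    [hP : (stalkIdeal (vanishingIdeal C₀) x₀).IsPrime]
    (w : X₀.presheaf.stalk x₀) (hw : stalkIdeal (vanishingIdeal C₀) x₀ ⊔ Ideal.span {w} = maximalIdeal _)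
    (G : X₀.functionField) (hG : CleanRegAt p (RatFn.toFunctionField x₀) G) :
    (∃ (X : Scheme.{0}) (_ : IsIntegral X) (_ : IsLocallyNoetherian X) (σ : X ⟶ X₀) (_ : IsDominant σ) (C : Closeds X) (x : X)
        (n : ℕ), IsPointChainAlong σ C₀ C x n ∧ σ x = x₀ ∧ IsClosed ({x} : Set X) ∧
        CleanPermissibleAt p (RatFn.toFunctionField x) (RatFn.functionFieldMap σ G) (stalkIdeal (vanishingIdeal C) x)) ∨
      ((∀ (cc : Fin p → X₀.functionField) (R : X₀.presheaf.stalk x₀), (∃ j : Fin p, (j : ℕ) ≠ 0 ∧ cc j ≠ 0) →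
          (∑ j : Fin p, cc j ^ p * G ^ (j : ℕ)) = RatFn.toFunctionField x₀ R →
          ∃ c : X₀.presheaf.stalk x₀, R - c ^ p ∈ stalkIdeal (vanishingIdeal C₀) x₀ ^ 2) ∧
        ∃ (cc : Fin p → X₀.functionField) (m : ℕ) (s : Fin m → X₀.presheaf.stalk x₀) (a : Fin m → ℕ) (u : X₀.presheaf.stalk x₀)
          (γ π : Fin m → X₀.presheaf.stalk x₀) (k : Fin m → ℕ) (c : X₀.presheaf.stalk x₀),
          (∃ j : Fin p, (j : ℕ) ≠ 0 ∧ cc j ≠ 0) ∧ IsRsopPart s ∧ (∀ i, ¬ p ∣ a i) ∧ IsUnit u ∧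
          (∑ j : Fin p, cc j ^ p * G ^ (j : ℕ)) = RatFn.toFunctionField x₀ (u * ∏ i, s i ^ a i) ∧
          (∀ i, s i ∉ stalkIdeal (vanishingIdeal C₀) x₀) ∧ (∀ i, IsUnit (γ i)) ∧
          (∀ i, π i ∈ stalkIdeal (vanishingIdeal C₀) x₀) ∧ (∀ i, s i = γ i * w ^ k i + π i) ∧ p ∣ ∑ i, k i * a i ∧
          u * ∏ i, γ i ^ a i - c ^ p ∈ stalkIdeal (vanishingIdeal C₀) x₀) := by
  classical
  by_cases hres : ∀ (cc : Fin p → X₀.functionField) (R : X₀.presheaf.stalk x₀), (∃ j : Fin p, (j : ℕ) ≠ 0 ∧ cc j ≠ 0) →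
      (∑ j : Fin p, cc j ^ p * G ^ (j : ℕ)) = RatFn.toFunctionField x₀ R →
      ∃ c : X₀.presheaf.stalk x₀, R - c ^ p ∈ stalkIdeal (vanishingIdeal C₀) x₀ ^ 2
  · rcases exists_pointChain_cleanPermissibleAt_or_pthPower_of_cleanRegAt_of_isQuasiExcellent hX₀ hE p hC₀reg hx₀ hx₀C hdim₀ w hw G hG
      with hexit | hconf
    · exact Or.inl hexit
    · exact Or.inr ⟨hres, hconf⟩
  · left
    push Not at hres
    obtain ⟨cc, R, hcc, hX, hR⟩ := hres
    exact exists_pointChain_cleanPermissibleAt_of_rep_not_pow_mod_sq hX₀ hE p hC₀reg hx₀ hx₀C hdim₀ w hw G cc hcc R hX hR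

end Summit.ResolutionOfSingularities.ResolutionOfSingularities.Theorems.RadicialJung.CleanModels

end
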